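import Mathlib
import HarnessLib
import Literature.NumberTheory.GaloisRepresentations.OrdinaryGaloisRep
import Literature.NumberTheory.GaloisRepresentations.ResidualRepresentation
import Summits.Langlands.Langlands.Theorems.EisensteinProModularSeed.Negative.OrientedFrame
import Summits.Langlands.Langlands.Theorems.EisensteinProModularSeed.Negative.BorelAndEisenstein

/-!
# `EisensteinProModularSeed` (stmt-Langlands-12920), line `descend-raise-basechange`, stub S2
# `stub_levelRaisedEisensteinNewformQ` — I. Ribet's lattice, elementary form

Support file (`--supports stmt-Langlands-12920`) for the `ℚ`-side package of the line.  Everything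
here is PROVED and self-contained (no named fact, no definition):

* `exists_unipotent_gl`, `exists_dw_gl` and the conjugation formulas `dw_conj`,
  `unipotent_conj_eq_diagonal` — explicit frames in `GL₂`;
* `exists_residually_borel_frame` — for a continuous irreducible `ρ : G → GL₂(ℚ̄_p)` on a compact
  group with `tr ρ ≡ 1 + η` (`η` a unit-valued character) and a frame `R` diagonalising `ρ(g₀)` with
  lower-right entry `1` at an element where `η̄(g₀) ≠ 1`, a frame `R · (0 1; t 0)` in which `ρ` is
  INTEGRAL and residually upper triangular with ORDERED residual diagonal `(1, η̄)`: the elementary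
  core of Ribet's lemma (Invent. Math. 34 (1976), Prop. 2.1) — the traces of `ρ(g)` and `ρ(g₀ g)`
  give `a ≡ η`, `d ≡ 1`, hence `c(g) b(g') ≡ 0`, and `t = c(g₁)` of maximal norm (compactness; `c ≢ 0`
  by irreducibility, `Negative.not_isIrreducible_of_conj_upperTriangular`) rescales the lattice;
* `exists_integralModel_of_frame` — packaging as `FramedRep.HasUpperTriangularIntegralModel` with the
  diagonal congruences; `exists_unipotent_diag_frame` — diagonalising at a window element.

References: K. Ribet, *A modular construction of unramified p-extensions of ℚ(μ_p)*, Invent. Math.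
34 (1976), §2; J.-P. Serre, *Abelian ℓ-adic representations* (1968), I.1.1. [folklore]
-/

set_option linter.dupNamespace false -- project-wide option (lakefile weak.linter.dupNamespace); `Summit.Langlands.Langlands` is the mandated namespace

noncomputable section

namespace Summit.Langlands.Langlands.Theorems.SkinnerWilesDefectOne.EisensteinProModularSeed

open Literature.NumberTheory.GaloisRepresentations
open IsLocalRing
open scoped MatrixGroups Matrix

section Gadgets

variable {A : Type*} [Field A]

/-- The unipotent matrix `(1 x; 0 1)` and its inverse, as an element of `GL₂`. [folklore] -/
theorem exists_unipotent_gl (x : A) :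
    ∃ U : GL (Fin 2) A, U.val = !![1, x; 0, 1] ∧ (U⁻¹).val = !![1, -x; 0, 1] :=
  ⟨⟨!![1, x; 0, 1], !![1, -x; 0, 1],
    by rw [Matrix.mul_fin_two]; ext i j; fin_cases i <;> fin_cases j <;> simp,
    by rw [Matrix.mul_fin_two]; ext i j; fin_cases i <;> fin_cases j <;> simp⟩, rfl, rfl⟩

/-- The matrix `diag(1, t) · (0 1; 1 0) = (0 1; t 0)` and its inverse, as an element of `GL₂`
(`t ≠ 0`). [folklore] -/
theorem exists_dw_gl (t : A) (ht : t ≠ 0) :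
    ∃ D : GL (Fin 2) A, D.val = !![0, 1; t, 0] ∧ (D⁻¹).val = !![0, t⁻¹; 1, 0] :=
  ⟨⟨!![0, 1; t, 0], !![0, t⁻¹; 1, 0],
    by rw [Matrix.mul_fin_two]; ext i j; fin_cases i <;> fin_cases j <;> simp [ht],
    by rw [Matrix.mul_fin_two]; ext i j; fin_cases i <;> fin_cases j <;> simp [ht]⟩, rfl, rfl⟩

/-- Conjugation by `(0 1; t 0)`: `(0 1; t 0)⁻¹ M (0 1; t 0) = (m₁₁, t⁻¹ m₁₀; t m₀₁, m₀₀)`. [folklore] -/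
theorem dw_conj (t : A) (ht : t ≠ 0) (D : GL (Fin 2) A) (hD : D.val = !![0, 1; t, 0])
    (hDi : (D⁻¹).val = !![0, t⁻¹; 1, 0]) (M : GL (Fin 2) A) :
    (D⁻¹ * M * D).val = !![M.val 1 1, t⁻¹ * M.val 1 0; t * M.val 0 1, M.val 0 0] := by
  rw [Units.val_mul, Units.val_mul, hDi, hD, Matrix.eta_fin_two M.val, Matrix.mul_fin_two,
    Matrix.mul_fin_two]
  ext i j; fin_cases i <;> fin_cases j <;> simp
  · rw [mul_comm, ← mul_assoc, mul_inv_cancel₀ ht, one_mul]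
  · ring

/-- Conjugation of an upper triangular matrix with lower-right entry `1` and upper-left entry
`e ≠ 1` by the unipotent `(1 x; 0 1)`, `x = m₀₁ / (1 - e)`, is the diagonal matrix `diag(e, 1)`.
[folklore] -/
theorem unipotent_conj_eq_diagonal (M : GL (Fin 2) A) (h10 : M.val 1 0 = 0) (h11 : M.val 1 1 = 1)
    (he : M.val 0 0 ≠ 1) (U : GL (Fin 2) A) (hU : U.val = !![1, M.val 0 1 / (1 - M.val 0 0); 0, 1])
    (hUi : (U⁻¹).val = !![1, -(M.val 0 1 / (1 - M.val 0 0)); 0, 1]) :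
    (U⁻¹ * M * U).val = !![M.val 0 0, 0; 0, 1] := by
  set x := M.val 0 1 / (1 - M.val 0 0) with hx
  have h1e : (1 - M.val 0 0) ≠ 0 := sub_ne_zero.mpr (Ne.symm he)
  have hkey : M.val 0 0 * x + M.val 0 1 - x = 0 := by
    rw [hx]; field_simp; ring
  rw [Units.val_mul, Units.val_mul, hUi, hU, Matrix.eta_fin_two M.val, Matrix.mul_fin_two,
    Matrix.mul_fin_two, h10, h11]
  ext i j; fin_cases i <;> fin_cases j <;> simp
  · linear_combination hkey

end Gadgets

/-! ### Valuation bookkeeping on `ℚ̄_p` -/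

section Val

variable {p : ℕ} [Fact p.Prime]

/-- `v (x - y) < 1` from `v x < 1`, `v y < 1`. [folklore] -/
theorem v_sub_lt_one {x y : PadicAlgCl p} (hx : Valued.v x < 1) (hy : Valued.v y < 1) : Valued.v (x - y) < 1 :=
  (Valuation.map_sub _ x y).trans_lt (max_lt hx hy)

/-- `v (x + y) < 1` from `v x < 1`, `v y < 1`. [folklore] -/
theorem v_add_lt_one {x y : PadicAlgCl p} (hx : Valued.v x < 1) (hy : Valued.v y < 1) : Valued.v (x + y) < 1 :=
  Valuation.map_add_lt _ hx hy

/-- `v (x * y) < 1` from `v x < 1`, `v y ≤ 1`. [folklore] -/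
theorem v_mul_lt_one_left {x y : PadicAlgCl p} (hx : Valued.v x < 1) (hy : Valued.v y ≤ 1) : Valued.v (x * y) < 1 := by
  rw [map_mul]; exact mul_lt_one_of_nonneg_of_lt_one_left zero_le hx hy

/-- `v (x * y) < 1` from `v x ≤ 1`, `v y < 1`. [folklore] -/
theorem v_mul_lt_one_right {x y : PadicAlgCl p} (hx : Valued.v x ≤ 1) (hy : Valued.v y < 1) : Valued.v (x * y) < 1 := by
  rw [mul_comm]; exact v_mul_lt_one_left hy hx

/-- Cancel a unit: `v u = 1` and `v (u * x) < 1` give `v x < 1`. [folklore] -/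
theorem v_lt_one_of_unit_mul {u x : PadicAlgCl p} (hu : Valued.v u = 1) (h : Valued.v (u * x) < 1) : Valued.v x < 1 := by
  rwa [map_mul, hu, one_mul] at h

/-- An element congruent to one of valuation `≤ 1` has valuation `≤ 1`. [folklore] -/
theorem v_le_one_of_sub_lt {x y : PadicAlgCl p} (h : Valued.v (x - y) < 1) (hy : Valued.v y ≤ 1) : Valued.v x ≤ 1 := by
  have : x = (x - y) + y := by ring
  rw [this]
  exact (Valuation.map_add _ _ _).trans (max_le h.le hy)

/-- If `v (x - 1)` is not `< 1` for `x` of valuation `1`, then `v (x - 1) = 1`. [folklore] -/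
theorem v_sub_one_eq_one {x : PadicAlgCl p} (hx : Valued.v x = 1) (h : ¬ Valued.v (x - 1) < 1) : Valued.v (x - 1) = 1 :=
  le_antisymm ((Valuation.map_sub _ x 1).trans (by rw [hx, Valuation.map_one, max_self])) (not_lt.mp h)

end Val

/-! ### The residually Borel frame (Ribet's lattice, elementary form) -/

section Frame

variable {p : ℕ} [Fact p.Prime]
variable {G : Type*} [Group G] [TopologicalSpace G] [CompactSpace G]

/-- **The residually Borel frame.**  Let `ρ : G → GL₂(ℚ̄_p)` be continuous and irreducible on a
compact group, `η : G → ℚ̄_pˣ` a continuous unit-valued character with `tr ρ(g) ≡ 1 + η(g)` for all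
`g` (congruences modulo the maximal ideal `{v < 1}` of `𝒪_{ℚ̄_p}`), and `R` a frame in which
`ρ(g₀)` is diagonal with lower-right entry `1` at an element `g₀` with `η(g₀) ≢ 1`.  Then for a
suitable `t ≠ 0` the frame `R · (0 1; t 0)` makes `ρ` INTEGRAL and upper triangular modulo the
maximal ideal with ordered residual diagonal `(1, η̄)`.  (In the frame `R` the traces of `ρ(g)` and
`ρ(g₀ g)` give `a ≡ η`, `d ≡ 1`, whence `c(g) b(g') ≡ 0`; take `t = c(g₁)` of maximal norm, non-zero
by irreducibility.)  This is the elementary core of Ribet's lemma on lattices with prescribed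
reduction order (Ribet 1976, Prop. 2.1), in the form needed here. [folklore] -/
theorem exists_residually_borel_frame :
    ∀ {p : ℕ} [Fact p.Prime] {G : Type} [Group G] [TopologicalSpace G] [CompactSpace G]
      (ρ : Literature.NumberTheory.GaloisRepresentations.FramedRep G (PadicAlgCl p) 2), ρ.IsIrreducible →
      ∀ (η : G →ₜ* (PadicAlgCl p)ˣ), (∀ g, Valued.v ((η g : (PadicAlgCl p)ˣ) : PadicAlgCl p) = 1) →
      (∀ g, Valued.v (Matrix.trace (ρ g).val - (1 + ((η g : (PadicAlgCl p)ˣ) : PadicAlgCl p))) < 1) →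
      ∀ (R : Matrix.GeneralLinearGroup (Fin 2) (PadicAlgCl p)) (g₀ : G),
      (R⁻¹ * ρ g₀ * R).val 0 1 = 0 → (R⁻¹ * ρ g₀ * R).val 1 0 = 0 → (R⁻¹ * ρ g₀ * R).val 1 1 = 1 →
      ¬ Valued.v (((η g₀ : (PadicAlgCl p)ˣ) : PadicAlgCl p) - 1) < 1 →
      ∃ D : Matrix.GeneralLinearGroup (Fin 2) (PadicAlgCl p), (D⁻¹).val 0 0 = 0 ∧ ∀ g,
        (∀ i j, Valued.v (((R * D)⁻¹ * ρ g * (R * D)).val i j) ≤ 1) ∧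
        Valued.v (((R * D)⁻¹ * ρ g * (R * D)).val 1 0) < 1 ∧
        Valued.v (((R * D)⁻¹ * ρ g * (R * D)).val 0 0 - 1) < 1 ∧
        Valued.v (((R * D)⁻¹ * ρ g * (R * D)).val 1 1 -
          ((η g : (PadicAlgCl p)ˣ) : PadicAlgCl p)) < 1 := by
  intro p _ G _ _ _ ρ hirr η hη htr R g₀ h01 h10 h11 hdist
  -- notation: `e g = η(g)`, `M g = R⁻¹ ρ(g) R` with entries `a b c d`
  set e : G → PadicAlgCl p := fun g => ((η g : (PadicAlgCl p)ˣ) : PadicAlgCl p) with he_def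
  set M : G → GL (Fin 2) (PadicAlgCl p) := fun g => R⁻¹ * ρ g * R with hM_def
  have hMmul : ∀ g g', M (g * g') = M g * M g' := fun g g' => by
    simp only [hM_def, map_mul]; group
  have hemul : ∀ g g', e (g * g') = e g * e g' := fun g g' => by
    simp only [he_def, map_mul, Units.val_mul]
  have he1 : ∀ g, Valued.v (e g) ≤ 1 := fun g => (hη g).le
  -- traces in the frame `R`
  have htrM : ∀ g, Matrix.trace (M g).val = Matrix.trace (ρ g).val := fun g => by
    simp only [hM_def, Units.val_mul]
    exact Matrix.trace_units_conj' R (ρ g).val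
  have htr' : ∀ g, Valued.v ((M g).val 0 0 + (M g).val 1 1 - (1 + e g)) < 1 := fun g => by
    have := htr g
    rwa [← htrM g, Matrix.trace_fin_two] at this
  -- `ε₀ ≡ η(g₀)` and `ε₀ - 1` is a unit
  set ε₀ := (M g₀).val 0 0 with hε₀
  have hε : Valued.v (ε₀ - e g₀) < 1 := by
    have := htr' g₀
    rw [h11] at this
    convert this using 2; ring
  have hεle : Valued.v ε₀ ≤ 1 := v_le_one_of_sub_lt hε (he1 g₀)
  have hε1 : Valued.v (ε₀ - 1) = 1 := by
    have h1 : Valued.v (e g₀ - 1) = 1 := v_sub_one_eq_one (hη g₀) hdist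
    have : ε₀ - 1 = (ε₀ - e g₀) + (e g₀ - 1) := by ring
    rw [this, Valuation.map_add_eq_of_lt_right _ (by rwa [h1]), h1]
  -- the diagonal shape of `M g₀`
  have hMg₀ : (M g₀).val = !![ε₀, 0; 0, 1] := by
    rw [Matrix.eta_fin_two (M g₀).val, h01, h10, h11]
  -- second trace identity: `tr M(g₀ g) = ε₀ a + d ≡ 1 + η(g₀) η(g) ≡ 1 + ε₀ η(g)`
  have htr2 : ∀ g, Valued.v (ε₀ * (M g).val 0 0 + (M g).val 1 1 - (1 + ε₀ * e g)) < 1 := fun g => by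
    have h1 := htr' (g₀ * g)
    have hprod : (M (g₀ * g)).val = !![ε₀, 0; 0, 1] * (M g).val := by
      rw [hMmul, Units.val_mul, hMg₀]
    have h00 : (M (g₀ * g)).val 0 0 = ε₀ * (M g).val 0 0 := by
      rw [hprod, Matrix.eta_fin_two (M g).val, Matrix.mul_fin_two]; simp
    have h11' : (M (g₀ * g)).val 1 1 = (M g).val 1 1 := by
      rw [hprod, Matrix.eta_fin_two (M g).val, Matrix.mul_fin_two]; simp
    rw [h00, h11', hemul] at h1
    -- replace `η(g₀)` by `ε₀`
    have h2 : Valued.v ((e g₀ - ε₀) * e g) < 1 :=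
      v_mul_lt_one_left (by rw [← Valuation.map_neg, neg_sub]; exact hε) (he1 g)
    have := v_add_lt_one h1 h2
    convert this using 2; ring
  -- `a ≡ η`, `d ≡ 1`, both integral
  have ha : ∀ g, Valued.v ((M g).val 0 0 - e g) < 1 := fun g => by
    have h := v_sub_lt_one (htr2 g) (htr' g)
    have : ε₀ * (M g).val 0 0 + (M g).val 1 1 - (1 + ε₀ * e g) -
        ((M g).val 0 0 + (M g).val 1 1 - (1 + e g)) = (ε₀ - 1) * ((M g).val 0 0 - e g) := by ring
    rw [this] at h
    exact v_lt_one_of_unit_mul hε1 h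
  have hd : ∀ g, Valued.v ((M g).val 1 1 - 1) < 1 := fun g => by
    have h := v_sub_lt_one (htr' g) (ha g)
    convert h using 2; ring
  have ha1 : ∀ g, Valued.v ((M g).val 0 0) ≤ 1 := fun g => v_le_one_of_sub_lt (ha g) (he1 g)
  have hd1 : ∀ g, Valued.v ((M g).val 1 1) ≤ 1 := fun g =>
    v_le_one_of_sub_lt (hd g) (by rw [Valuation.map_one])
  -- `c(g) b(g') ≡ 0`
  have hcb : ∀ g g', Valued.v ((M g).val 1 0 * (M g').val 0 1) < 1 := fun g g' => by
    have hprod : (M (g * g')).val 1 1 = (M g).val 1 0 * (M g').val 0 1 + (M g).val 1 1 * (M g').val 1 1 := by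
      rw [hMmul, Units.val_mul, Matrix.mul_apply, Fin.sum_univ_two]
    have h1 : Valued.v ((M (g * g')).val 1 1 - 1) < 1 := hd (g * g')
    rw [hprod] at h1
    have h2 : Valued.v ((M g).val 1 1 * (M g').val 1 1 - 1) < 1 := by
      have : (M g).val 1 1 * (M g').val 1 1 - 1 =
          ((M g).val 1 1 - 1) * (M g').val 1 1 + ((M g').val 1 1 - 1) := by ring
      rw [this]
      exact v_add_lt_one (v_mul_lt_one_left (hd g) (hd1 g')) (hd g')
    have := v_sub_lt_one h1 h2
    convert this using 2; ring
  -- `c` does not vanish identically (irreducibility)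
  have hc : ∃ g, (M g).val 1 0 ≠ 0 := by
    by_contra hall
    push Not at hall
    exact Summit.Langlands.Langlands.Theorems.EisensteinProModularSeed.Negative.not_isIrreducible_of_conj_upperTriangular
      ρ R hall hirr
  -- maximise `‖c‖` over the compact group
  have hcont : Continuous fun g => ‖(M g).val 1 0‖ := by
    refine continuous_norm.comp ?_
    have hMc : Continuous fun g => ((M g : GL (Fin 2) (PadicAlgCl p)) : Matrix (Fin 2) (Fin 2) (PadicAlgCl p)) :=
      Units.continuous_val.comp ((continuous_const.mul (map_continuous ρ)).mul continuous_const)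
    exact hMc.matrix_elem 1 0
  obtain ⟨g₁, -, hg₁⟩ := isCompact_univ.exists_isMaxOn Set.univ_nonempty hcont.continuousOn
  have hmax : ∀ g, ‖(M g).val 1 0‖ ≤ ‖(M g₁).val 1 0‖ := fun g => hg₁ (Set.mem_univ g)
  set t := (M g₁).val 1 0 with ht_def
  have ht : t ≠ 0 := by
    obtain ⟨g, hg⟩ := hc
    intro h0
    have := hmax g
    rw [h0, norm_zero, norm_le_zero_iff] at this
    exact hg this
  have hvmax : ∀ g, Valued.v ((M g).val 1 0) ≤ Valued.v t := fun g => by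
    change ‖(M g).val 1 0‖₊ ≤ ‖t‖₊
    exact hmax g
  obtain ⟨D, hD, hDi⟩ := exists_dw_gl t ht
  refine ⟨D, by rw [hDi]; rfl, fun g => ?_⟩
  have hconj : (R * D)⁻¹ * ρ g * (R * D) = D⁻¹ * M g * D := by
    simp only [hM_def]; group
  rw [hconj, dw_conj t ht D hD hDi (M g)]
  have hvt : Valued.v t ≠ 0 := (Valuation.ne_zero_iff _).mpr ht
  have h01v : Valued.v (t⁻¹ * (M g).val 1 0) ≤ 1 := by
    rw [map_mul, map_inv₀]
    exact inv_mul_le_one_of_le₀ (hvmax g) zero_le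
  have h10v : Valued.v (t * (M g).val 0 1) < 1 := hcb g₁ g
  refine ⟨fun i j => ?_, h10v, hd g, ha g⟩
  fin_cases i <;> fin_cases j
  · exact hd1 g
  · exact h01v
  · exact h10v.le
  · exact ha1 g

end Frame

/-! ### Packaging: the re-framed representation and its integral model -/

section Package

variable {p : ℕ} [Fact p.Prime] {O : ValuationSubring (PadicAlgCl p)}
variable {G : Type*} [Group G] [TopologicalSpace G]

/-- Unfolding: `(conj P⁻¹ ρ) g = P⁻¹ ρ(g) P`. [folklore] -/
theorem conj_inv_apply (ρ : FramedRep G (PadicAlgCl p) 2) (P : GL (Fin 2) (PadicAlgCl p)) (g : G) :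
    FramedRep.conj P⁻¹ ρ g = P⁻¹ * ρ g * P := by
  rw [FramedRep.conj_apply, inv_inv]

/-- **Integral model in a frame with integral entries.**  If all entries of `P⁻¹ ρ(g) P` have
valuation `≤ 1` (`O = 𝒪_{ℚ̄_p}`), the re-framed representation `conj P⁻¹ ρ` has an integral model
`ρ₀ : G → GL₂(O)` in the same frame; if moreover the lower-left entries have valuation `< 1`, the
upper-left ones are `≡ 1` and the lower-right ones `≡ η`, then `ρ₀` is a residually upper-triangular
integral model with ordered residual diagonal `(1, η̄)`. [folklore] -/
theorem exists_integralModel_of_frame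
    (hO : O = (Valued.v : Valuation (PadicAlgCl p) NNReal).valuationSubring)
    (ρ : FramedRep G (PadicAlgCl p) 2) (η : G → PadicAlgCl p) (P : GL (Fin 2) (PadicAlgCl p))
    (hint : ∀ g i j, Valued.v ((P⁻¹ * ρ g * P).val i j) ≤ 1)
    (h10 : ∀ g, Valued.v ((P⁻¹ * ρ g * P).val 1 0) < 1)
    (h00 : ∀ g, Valued.v ((P⁻¹ * ρ g * P).val 0 0 - 1) < 1)
    (h11 : ∀ g, Valued.v ((P⁻¹ * ρ g * P).val 1 1 - η g) < 1) :
    ∃ ρ₀ : G →* GL (Fin 2) O,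
      FramedRep.HasUpperTriangularIntegralModel (FramedRep.conj P⁻¹ ρ) ρ₀ ∧
      ∀ g, ((ρ₀ g).val 0 0 - 1 : O) ∈ maximalIdeal O ∧
        Valued.v (((ρ₀ g).val 1 1 : PadicAlgCl p) - η g) < 1 := by
  have hmem : ∀ g, FramedRep.conj P⁻¹ ρ g ∈ (Matrix.GeneralLinearGroup.map (n := Fin 2) O.subtype).range := by
    intro g
    rw [mem_range_generalLinearGroup_map_iff]
    refine ⟨fun i j => ?_, fun i j => ?_⟩
    · rw [conj_inv_apply, hO, Valuation.mem_valuationSubring_iff]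
      exact hint g i j
    · rw [← map_inv, conj_inv_apply, hO, Valuation.mem_valuationSubring_iff]
      exact hint g⁻¹ i j
  obtain ⟨ρ₀, hρ₀⟩ := exists_monoidHom_map_eq (FramedRep.conj P⁻¹ ρ).toMonoidHom hmem
  have hentry : ∀ g i j, ((ρ₀ g).val i j : PadicAlgCl p) = (P⁻¹ * ρ g * P).val i j := by
    intro g i j
    rw [← conj_inv_apply ρ P g]
    change _ = ((FramedRep.conj P⁻¹ ρ).toMonoidHom g).val i j
    rw [← hρ₀ g]
    rfl
  refine ⟨ρ₀, ⟨hρ₀, ?_⟩, fun g => ⟨?_, ?_⟩⟩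
  · rw [isResiduallyUpperTriangular_two_iff]
    intro g
    apply Summit.Langlands.Langlands.Theorems.EisensteinProModularSeed.Negative.mem_maximalIdeal_of_v_lt_one hO
    rw [hentry]
    exact h10 g
  · apply Summit.Langlands.Langlands.Theorems.EisensteinProModularSeed.Negative.mem_maximalIdeal_of_v_lt_one hO
    push_cast
    rw [hentry]
    exact h00 g
  · rw [hentry]
    exact h11 g

/-- **Diagonalising at a window element.**  If `Q⁻¹ ρ(g₀) Q` is upper triangular with lower-right
entry `1`, `tr ρ ≡ 1 + η` and `η̄(g₀) ≠ 1`, then its upper-left entry is not `1`, and the unipotent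
change of frame `Q ↦ Q · (1 x; 0 1)`, `x = b / (1 - ε₀)`, makes `ρ(g₀)` DIAGONAL with lower-right entry
`1`. [folklore] -/
theorem exists_unipotent_diag_frame (ρ : FramedRep G (PadicAlgCl p) 2) (η : G →ₜ* (PadicAlgCl p)ˣ)
    (htr : ∀ g, Valued.v (Matrix.trace (ρ g).val - (1 + ((η g : (PadicAlgCl p)ˣ) : PadicAlgCl p))) < 1)
    (Q : GL (Fin 2) (PadicAlgCl p)) (g₀ : G)
    (h10 : (Q⁻¹ * ρ g₀ * Q).val 1 0 = 0) (h11 : (Q⁻¹ * ρ g₀ * Q).val 1 1 = 1)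
    (hdist : ¬ Valued.v (((η g₀ : (PadicAlgCl p)ˣ) : PadicAlgCl p) - 1) < 1) :
    ∃ U : GL (Fin 2) (PadicAlgCl p), (U⁻¹).val 1 0 = 0 ∧
      ((Q * U)⁻¹ * ρ g₀ * (Q * U)).val 0 1 = 0 ∧
      ((Q * U)⁻¹ * ρ g₀ * (Q * U)).val 1 0 = 0 ∧
      ((Q * U)⁻¹ * ρ g₀ * (Q * U)).val 1 1 = 1 := by
  set Sx := Q⁻¹ * ρ g₀ * Q with hSx
  have hε1 : Sx.val 0 0 ≠ 1 := by
    intro h1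
    have h := htr g₀
    have htrS : Matrix.trace Sx.val = Matrix.trace (ρ g₀).val := by
      rw [hSx, Units.val_mul, Units.val_mul]; exact Matrix.trace_units_conj' Q _
    rw [← htrS, Matrix.trace_fin_two, h11, h1, ← Valuation.map_neg] at h
    apply hdist
    convert h using 2; ring
  obtain ⟨U, hU, hUi⟩ := exists_unipotent_gl (Sx.val 0 1 / (1 - Sx.val 0 0))
  refine ⟨U, by rw [hUi]; rfl, ?_⟩
  have hconj : (Q * U)⁻¹ * ρ g₀ * (Q * U) = U⁻¹ * Sx * U := by rw [hSx]; group
  rw [hconj, unipotent_conj_eq_diagonal Sx h10 h11 hε1 U hU hUi]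
  exact ⟨rfl, rfl, rfl⟩

end Package

end Summit.Langlands.Langlands.Theorems.SkinnerWilesDefectOne.EisensteinProModularSeed
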